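import Mathlib.NumberTheory.Cyclotomic.CyclotomicCharacter
import Mathlib.GroupTheory.Solvable
import Mathlib.FieldTheory.Galois.Basic
import HarnessLib

/-!
# Radicals are fixed by the second derived subgroup of the automorphism group of a field extension

Classical Galois theory of radical extensions: for a field extension `L/k` with automorphism group
`G = Gal(L/k)`, (1) the commutator subgroup `G'` fixes every root of unity of `L` — the action of `G` on the
`n`-th roots of unity factors through the abelian group `(ℤ/d)^×` (the mod-`n` cyclotomic character); (2) the
second derived subgroup `G'' = [G', G']` fixes every RADICAL `f ∈ L`, `f ^ m ∈ k` (`m ≥ 1`): on `G'` the Kummer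
cocycle `σ ↦ σ(f)/f` takes values in the `m`-th roots of unity, which `G'` fixes, so it is a homomorphism to an
abelian group and kills `G''`.  [Lang, *Algebra*, Ch. VI §3 (roots of unity) and §6 (cyclic / Kummer extensions)]

Motivation (cell abc-iut, [IUTchI] Example 5.1 (v) / Remark 3.1.7 (ii)–(iii)): the printed mechanism behind "the
`π₁^rat(†𝒟^⊛)`-action on the ∞κ×-coric functions does NOT factor through `π₁^{κ-sol}`" is «`G_{F_mod}` is not
prosolvable»; at the Galois toy `ℚ̄ ↶ G_ℚ` of the layer-5 certificate's NV annex the ∞κ-coric functions are radicals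
of powers of `2`, fixed by `G_ℚ''`, while `G_ℚ'' ≠ 1` because `G_ℚ` is not solvable.  No IUT content here; theorem-only,
classical, Mathlib vocabulary (`commutator`, `derivedSeries`, `rootsOfUnity`, `modularCyclotomicCharacter'`).
-/

namespace Literature.NumberTheory.NumberFields

open Polynomial
open scoped commutatorElement

variable {k L : Type*} [Field k] [Field L] [Algebra k L]

/-- The monoid homomorphism `Gal(L/k) → (L ≃+* L)` forgetting `k`-linearity. [folklore] -/
private theorem exists_toRingEquivHom :
    ∃ φ : (L ≃ₐ[k] L) →* (L ≃+* L), ∀ σ : L ≃ₐ[k] L, ∀ x : L, φ σ x = σ x :=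
  ⟨{ toFun := fun σ => σ.toRingEquiv, map_one' := rfl, map_mul' := fun _ _ => rfl }, fun _ _ => rfl⟩

/-- **The commutator subgroup of `Gal(L/k)` fixes every root of unity of `L`**: the action on the `n`-th roots of
unity factors through the abelian group `(ℤ/d)^×` via the mod-`n` cyclotomic character.
[cite: Lang2002, Ch. VI §3] -/
theorem commutator_apply_eq_self_of_pow_eq_one {σ : L ≃ₐ[k] L} (hσ : σ ∈ commutator (L ≃ₐ[k] L))
    {ζ : L} {n : ℕ} (hn : 0 < n) (hζ : ζ ^ n = 1) : σ ζ = ζ := by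
  classical
  haveI : NeZero n := ⟨hn.ne'⟩
  have hζ0 : ζ ≠ 0 := fun h0 => by
    rw [h0, zero_pow hn.ne'] at hζ
    exact zero_ne_one hζ
  obtain ⟨φ, hφ⟩ := exists_toRingEquivHom (k := k) (L := L)
  -- the cyclotomic character kills commutators
  let χ : (L ≃ₐ[k] L) →* (ZMod (Nat.card (rootsOfUnity n L)))ˣ := (modularCyclotomicCharacter' L n).comp φ
  have hker : χ σ = 1 := Abelianization.commutator_subset_ker χ hσ
  have h1 : χ 1 = 1 := map_one χ
  -- the unit `t = ζ`
  let t : Lˣ := Units.mk0 ζ hζ0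
  have ht : t ∈ rootsOfUnity n L := by
    rw [mem_rootsOfUnity']
    exact hζ
  have hspec := modularCyclotomicCharacter'.spec' L n (φ σ) ht
  have hspec1 := modularCyclotomicCharacter'.spec' L n (φ 1) ht
  have hχ : modularCyclotomicCharacter' L n (φ σ) = modularCyclotomicCharacter' L n (φ 1) := by
    change χ σ = χ 1
    rw [hker, h1]
  rw [hχ] at hspec
  have h2 : (φ σ) (t : L) = (φ 1) (t : L) := hspec.trans hspec1.symm
  rw [hφ, hφ] at h2
  exact h2

/-- **The second derived subgroup of `Gal(L/k)` fixes every radical**: if `f ^ m ∈ k` with `m ≥ 1` then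
`g f = f` for every `g ∈ G'' = [G', G']`, `G = Gal(L/k)` — the Kummer cocycle `σ ↦ σ(f)/f` is, on `G'`, a
homomorphism to the (abelian) `m`-th roots of unity. [cite: Lang2002, Ch. VI §6] -/
theorem derivedSeries_two_apply_eq_self_of_pow_mem {g : L ≃ₐ[k] L} (hg : g ∈ derivedSeries (L ≃ₐ[k] L) 2)
    {f : L} {m : ℕ} (hm : 0 < m) (hf : f ^ m ∈ Set.range (algebraMap k L)) : g f = f := by
  classical
  obtain ⟨c, hc⟩ := hf
  by_cases hf0 : f = 0
  · rw [hf0, map_zero]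
  -- every `σ` fixes `f ^ m`; the Kummer cocycle `u σ := σ f / f` is an `m`-th root of unity
  have hfix : ∀ σ : L ≃ₐ[k] L, σ (f ^ m) = f ^ m := fun σ => by rw [← hc, AlgEquiv.commutes]
  have hum : ∀ σ : L ≃ₐ[k] L, (σ f / f) ^ m = 1 := by
    intro σ
    rw [div_pow, ← map_pow, hfix, div_self (pow_ne_zero _ hf0)]
  -- on the commutator subgroup `G'` the cocycle is multiplicative
  let D : Subgroup (L ≃ₐ[k] L) := commutator (L ≃ₐ[k] L)
  have hmul : ∀ σ τ : L ≃ₐ[k] L, σ ∈ D → (σ * τ) f / f = (σ f / f) * (τ f / f) := by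
    intro σ τ hσ
    have hτf : τ f = (τ f / f) * f := by rw [div_mul_cancel₀ _ hf0]
    have hσu : σ (τ f / f) = τ f / f := commutator_apply_eq_self_of_pow_eq_one hσ hm (hum τ)
    rw [AlgEquiv.mul_apply, hτf, map_mul, hσu]
    field_simp
  -- hence it kills every commutator of elements of `G'`
  have hcomm : ∀ σ ∈ D, ∀ τ ∈ D, (⁅σ, τ⁆ : L ≃ₐ[k] L) f = f := by
    intro σ hσ τ hτ
    have hσinv : σ⁻¹ ∈ D := D.inv_mem hσ
    have hτinv : τ⁻¹ ∈ D := D.inv_mem hτ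
    -- `u(σ⁻¹) = (u σ)⁻¹`
    have hinvσ : (σ⁻¹ f / f) * (σ f / f) = 1 := by
      have h := hmul σ⁻¹ σ hσinv
      rw [inv_mul_cancel, AlgEquiv.one_apply, div_self hf0] at h
      exact h.symm
    have hinvτ : (τ⁻¹ f / f) * (τ f / f) = 1 := by
      have h := hmul τ⁻¹ τ hτinv
      rw [inv_mul_cancel, AlgEquiv.one_apply, div_self hf0] at h
      exact h.symm
    have hval : (⁅σ, τ⁆ : L ≃ₐ[k] L) f / f = 1 := by
      rw [commutatorElement_def, hmul _ _ (D.mul_mem (D.mul_mem hσ hτ) hσinv),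
        hmul _ _ (D.mul_mem hσ hτ), hmul _ _ hσ]
      calc σ f / f * (τ f / f) * (σ⁻¹ f / f) * (τ⁻¹ f / f)
          = ((σ⁻¹ f / f) * (σ f / f)) * ((τ⁻¹ f / f) * (τ f / f)) := by ring
        _ = 1 := by rw [hinvσ, hinvτ, one_mul]
    exact (div_eq_one_iff_eq hf0).1 hval
  -- `G'' = [G', G'] ≤ stabiliser of f`
  have hle : derivedSeries (L ≃ₐ[k] L) 2 ≤ MulAction.stabilizer (L ≃ₐ[k] L) f := by
    rw [derivedSeries_succ, derivedSeries_one, Subgroup.commutator_le]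
    intro σ hσ τ hτ
    exact hcomm σ hσ τ hτ
  exact hle hg

end Literature.NumberTheory.NumberFields
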